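import Mathlib.Algebra.Order.BigOperators.Group.Finset
import Mathlib.Algebra.BigOperators.Ring.Finset
import Mathlib.Order.Interval.Finset.Nat
import Mathlib.Tactic.Ring
import Mathlib.Tactic.GCongr
import Mathlib.Algebra.Group.Action.Defs
import HarnessLib

/-!
# Covering the digit range by windows: the pigeonhole step of Bourgain 2013, (2.30) — proved

Topic `Literature/NumberTheory/LFunctions`; proofs-only (theorems, no definition, no named fact).
Elementary counting used by the assembly of Theorem 1 of J. Bourgain, *Möbius–Walsh correlation
bounds and an estimate of Mauduit and Rivat*, J. Anal. Math. **119** (2013) 147–163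
(= arXiv:1109.2784) [Bourgain2013MoebiusWalsh]. After (2.29): "Recall that either `K = 0` or
`μ - ρ ≤ K < λ - μ - ρ` and hence, varying `K`, the intervals `[K, K + μ + ρ]` will cover
`[0, λ - 1]`. Thus we may choose `K` as to ensure that `|S'| ≥ max |S ∩ J| ≳ (μ/λ)|S|` (2.30)."
We record the covering and the resulting pigeonhole in the form the dyadic assembly consumes:
a bottom window `[0, b)`, sliding windows `[K, K + ℓ)` for `K₀ ≤ K ≤ K₁` (`K₀ ≤ b`, the top one
reaching `Λ ≤ K₁ + ℓ`):

* `card_le_windows` — `|U| ≤ |U ∩ [0,b)| + ∑_{m ≤ (K₁-K₀)/ℓ} |U ∩ [K₀ + mℓ, K₀ + (m+1)ℓ)| + |U ∩ [K₁, K₁+ℓ)|`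
  for `U ⊆ [0, Λ)`;
* `exists_heavy_window` — hence if `w((K₁-K₀)/ℓ + 3) < |U|`, some window carries more than `w`
  elements of `U`: the bottom one, or `[K, K+ℓ)` for some `K₀ ≤ K ≤ K₁`;
* `card_le_two_windows` — `U ⊆ [K, Λ)`, `K' ≤ K + ℓ`, `Λ ≤ K' + ℓ`: `|U| ≤ |U ∩ [K,K+ℓ)| + |U ∩ [K',K'+ℓ)|`
  (the two top windows used for the type-I sums treated as type-II sums, §3 (2.35)/(3.4)).

## References

* J. Bourgain, J. Anal. Math. 119 (2013) 147–163, §2 (2.30), §3 (3.4). [Bourgain2013MoebiusWalsh]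
-/

open Finset

namespace Literature.NumberTheory.LFunctions.MoebiusWalshTypeII

/-- **Covering `[0, Λ)` by the windows.** For `U ⊆ [0, Λ)`, `ℓ ≥ 1`, `K₀ ≤ b`, `K₀ ≤ K₁`,
`Λ ≤ K₁ + ℓ`:
`|U| ≤ |U ∩ [0,b)| + ∑_{m ≤ (K₁-K₀)/ℓ} |U ∩ [K₀+mℓ, K₀+mℓ+ℓ)| + |U ∩ [K₁, K₁+ℓ)|`.
[cite: Bourgain2013MoebiusWalsh, §2, after (2.29) ("varying K, the intervals [K, K+μ+ρ] will cover [0, λ-1]")] -/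
theorem card_le_windows (U : Finset ℕ) {Λ b ℓ K₀ K₁ : ℕ} (hU : ∀ x ∈ U, x < Λ) (hℓ : 0 < ℓ)
    (hb : K₀ ≤ b) (hK : K₀ ≤ K₁) (htop : Λ ≤ K₁ + ℓ) :
    U.card ≤ (U.filter (· < b)).card +
      ∑ m ∈ range ((K₁ - K₀) / ℓ + 1),
        (U.filter fun x => K₀ + m * ℓ ≤ x ∧ x < K₀ + m * ℓ + ℓ).card +
      (U.filter fun x => K₁ ≤ x ∧ x < K₁ + ℓ).card := by
  classical
  set M := (K₁ - K₀) / ℓ with hM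
  set Ub := U.filter (· < b) with hUb
  set Umid := U.filter fun x => b ≤ x ∧ x < K₁ with hUmid
  set Utop := U.filter fun x => K₁ ≤ x ∧ x < K₁ + ℓ with hUtop
  -- the three parts cover `U`
  have hcover : U ⊆ Ub ∪ Umid ∪ Utop := by
    intro x hx
    have hxΛ := hU x hx
    rw [Finset.mem_union, Finset.mem_union, hUb, hUmid, hUtop, Finset.mem_filter, Finset.mem_filter,
      Finset.mem_filter]
    by_cases h1 : x < b
    · exact Or.inl (Or.inl ⟨hx, h1⟩)
    · by_cases h2 : x < K₁
      · exact Or.inl (Or.inr ⟨hx, not_lt.1 h1, h2⟩)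
      · exact Or.inr ⟨hx, not_lt.1 h2, by omega⟩
  -- the middle part is covered by the sliding windows
  have hmid : Umid ⊆ (range (M + 1)).biUnion fun m =>
      U.filter fun x => K₀ + m * ℓ ≤ x ∧ x < K₀ + m * ℓ + ℓ := by
    intro x hx
    rw [hUmid, Finset.mem_filter] at hx
    obtain ⟨hxU, hxb, hxK⟩ := hx
    rw [Finset.mem_biUnion]
    refine ⟨(x - K₀) / ℓ, ?_, ?_⟩
    · rw [Finset.mem_range]
      have : (x - K₀) / ℓ ≤ M := by rw [hM]; exact Nat.div_le_div_right (by omega)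
      omega
    · rw [Finset.mem_filter]
      refine ⟨hxU, ?_, ?_⟩
      · have h := Nat.div_mul_le_self (x - K₀) ℓ
        omega
      · have h := Nat.lt_div_mul_add (a := x - K₀) hℓ
        have : x - K₀ < (x - K₀) / ℓ * ℓ + ℓ := h
        omega
  calc U.card ≤ (Ub ∪ Umid ∪ Utop).card := Finset.card_le_card hcover
    _ ≤ (Ub ∪ Umid).card + Utop.card := Finset.card_union_le _ _
    _ ≤ Ub.card + Umid.card + Utop.card := by
        gcongr; exact Finset.card_union_le _ _
    _ ≤ Ub.card + ∑ m ∈ range (M + 1),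
          (U.filter fun x => K₀ + m * ℓ ≤ x ∧ x < K₀ + m * ℓ + ℓ).card + Utop.card := by
        gcongr
        exact (Finset.card_le_card hmid).trans Finset.card_biUnion_le

/-- **Pigeonhole over the windows** (Bourgain 2013, (2.30)): under the hypotheses of
`card_le_windows`, if `w((K₁-K₀)/ℓ + 3) < |U|` then either the bottom window `[0, b)` or some
window `[K, K+ℓ)` with `K₀ ≤ K ≤ K₁` contains more than `w` elements of `U`.
[cite: Bourgain2013MoebiusWalsh, §2 (2.30)] -/
theorem exists_heavy_window (U : Finset ℕ) {Λ b ℓ K₀ K₁ : ℕ} (hU : ∀ x ∈ U, x < Λ) (hℓ : 0 < ℓ)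
    (hb : K₀ ≤ b) (hK : K₀ ≤ K₁) (htop : Λ ≤ K₁ + ℓ) {w : ℕ}
    (hw : w * ((K₁ - K₀) / ℓ + 3) < U.card) :
    w < (U.filter (· < b)).card ∨
      ∃ K, K₀ ≤ K ∧ K ≤ K₁ ∧ w < (U.filter fun x => K ≤ x ∧ x < K + ℓ).card := by
  by_contra hcon
  rw [not_or, not_lt, not_exists] at hcon
  obtain ⟨h0, hall⟩ := hcon
  have hwin : ∀ K, K₀ ≤ K → K ≤ K₁ → (U.filter fun x => K ≤ x ∧ x < K + ℓ).card ≤ w := by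
    intro K h1 h2
    by_contra h
    exact hall K ⟨h1, h2, not_le.1 h⟩
  have h := card_le_windows U hU hℓ hb hK htop
  set M := (K₁ - K₀) / ℓ with hM
  have hsum : ∑ m ∈ range (M + 1),
      (U.filter fun x => K₀ + m * ℓ ≤ x ∧ x < K₀ + m * ℓ + ℓ).card ≤ (M + 1) * w := by
    calc ∑ m ∈ range (M + 1), (U.filter fun x => K₀ + m * ℓ ≤ x ∧ x < K₀ + m * ℓ + ℓ).card
        ≤ ∑ _m ∈ range (M + 1), w := by
          refine Finset.sum_le_sum fun m hm => hwin (K₀ + m * ℓ) (by omega) ?_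
          rw [Finset.mem_range] at hm
          have h1 : m ≤ M := by omega
          have h2 : m * ℓ ≤ M * ℓ := Nat.mul_le_mul_right ℓ h1
          have h3 : M * ℓ ≤ K₁ - K₀ := by rw [hM]; exact Nat.div_mul_le_self _ _
          omega
      _ = (M + 1) * w := by rw [Finset.sum_const, Finset.card_range, smul_eq_mul]
  have htopw := hwin K₁ hK le_rfl
  have : U.card ≤ w * (M + 3) := by
    calc U.card ≤ w + (M + 1) * w + w := by
          refine h.trans ?_
          gcongr
      _ = w * (M + 3) := by ring
  omega

/-- **Two windows cover the top digits.** If `U ⊆ [K, Λ)`, `K' ≤ K + ℓ` and `Λ ≤ K' + ℓ`, then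
`|U| ≤ |U ∩ [K, K+ℓ)| + |U ∩ [K', K'+ℓ)|`.
[cite: Bourgain2013MoebiusWalsh, §3 (3.4) (windows of size μ at the top of the digit range)] -/
theorem card_le_two_windows (U : Finset ℕ) {K K' ℓ Λ : ℕ} (hU : ∀ x ∈ U, K ≤ x ∧ x < Λ)
    (hK : K' ≤ K + ℓ) (htop : Λ ≤ K' + ℓ) :
    U.card ≤ (U.filter fun x => K ≤ x ∧ x < K + ℓ).card +
      (U.filter fun x => K' ≤ x ∧ x < K' + ℓ).card := by
  classical
  have hcover : U ⊆ (U.filter fun x => K ≤ x ∧ x < K + ℓ) ∪ (U.filter fun x => K' ≤ x ∧ x < K' + ℓ) := by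
    intro x hx
    obtain ⟨h1, h2⟩ := hU x hx
    rw [Finset.mem_union, Finset.mem_filter, Finset.mem_filter]
    by_cases h : x < K + ℓ
    · exact Or.inl ⟨hx, h1, h⟩
    · exact Or.inr ⟨hx, by omega, by omega⟩
  exact (Finset.card_le_card hcover).trans (Finset.card_union_le _ _)

/-- The two-window pigeonhole: under the hypotheses of `card_le_two_windows`, one of the two
windows carries at least half of `U`: `|U| ≤ 2 |U ∩ [K,K+ℓ)|` or `|U| ≤ 2 |U ∩ [K',K'+ℓ)|`.
[cite: Bourgain2013MoebiusWalsh, §3 (3.4)] -/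
theorem card_le_two_mul_window_or (U : Finset ℕ) {K K' ℓ Λ : ℕ} (hU : ∀ x ∈ U, K ≤ x ∧ x < Λ)
    (hK : K' ≤ K + ℓ) (htop : Λ ≤ K' + ℓ) :
    U.card ≤ 2 * (U.filter fun x => K ≤ x ∧ x < K + ℓ).card ∨
      U.card ≤ 2 * (U.filter fun x => K' ≤ x ∧ x < K' + ℓ).card := by
  have h := card_le_two_windows U hU hK htop
  omega

end Literature.NumberTheory.LFunctions.MoebiusWalshTypeII
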